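import Summits.NavierStokesRegularity.NavierStokesRegularity.Theorems.DriftChargedClockCompositions
import HarnessLib

/-!
# DriftChargedClockClosers — door family S40 «DriftChargedClock»: ALL FOUR DOORS CLOSED BY NAME (§5)

P0-40 part 3 of 4: §5 (`driftChargedSmoothing_holds` (D1), `driftChargedTameness_holds` (D2), `driftChargedStrainFree_holds` (D3),
`parityRatioDoor_holds` (D4, S38-A0's proof shape at the sharp constant, under `maxHeartbeats 800000` as in the sketch)) of
nsreg-p1 g32's `r38/Sketch40.lean` sha16 6cf784e4a0d91d3a (ROUND-38 S40 «DriftChargedClock», memo c2f04749b4dda388 / v1.1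
de833dab5ad7c014), every declaration byte-identical, order preserved; imports part 2 `…Theorems.DriftChargedClockCompositions`;
cut prepared by ns-s29-p2 g5 per memo §8, `--supports stmt-NavierStokesRegularity-0056 --as helper`.  UNCONDITIONAL (no
named-fact hypothesis; std axioms per p1's `r38/axioms40.txt`).

HONEST FRAME: door family S40 «DriftChargedClock» = level-charged / velocity-free strain-clock CRITERIA about HYPOTHETICAL blow-up
profiles; items 0056 `NoTypeII`, 10661 and NS regularity are NOT proved; nothing here is a route or a summit statement.
-/

noncomputable section

open MeasureTheory Set Function Filter Metric Real InnerProductSpace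
open _root_.Topology
open scoped ENNReal NNReal RealInnerProductSpace ContDiff Laplacian Interval
open Literature.Analysis Literature.Analysis.FluidPDE
open Literature.Analysis.FluidPDE.VorticityDirectionDynamics

set_option linter.dupNamespace false

namespace Summit.NavierStokesRegularity.NavierStokesRegularity.Theorems.StrainDoors

open Summit.NavierStokesRegularity.NavierStokesRegularity.Theorems.ArgmaxDoors

-- nested operator types (second derivatives)
set_option maxSynthPendingDepth 3

/-! ## §5 Closers -/

/-- **door D1 «DriftChargedSmoothing» CLOSED** (no hypothesis). -/
theorem driftChargedSmoothing_holds : DriftChargedSmoothing :=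
  driftChargedSmoothing_of strainFrameOn_holds strainThresholdWeightedOn_holds

/-- **door D2 «DriftChargedTameness» CLOSED** (no hypothesis). -/
theorem driftChargedTameness_holds : DriftChargedTameness :=
  driftChargedTameness_of strainFrameOn_holds strainThresholdWeightedOn_holds

/-- **door D3 «DriftChargedStrainFree» CLOSED** (no hypothesis). -/
theorem driftChargedStrainFree_holds : DriftChargedStrainFree :=
  driftChargedStrainFree_of driftChargedTameness_holds

set_option maxHeartbeats 800000 in
/-- **Door D4 «ParityRatioDoor» PROVED** (S38-A0's proof at `κ = 0`): a bound `M` for the strain form at `t₀`; on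
`[t₀,T)` the CONSTANT barrier `B ≡ M' := max M l₀ + 1` with `φ ≡ 0` (`φB = 0 ≤ 0 = B'`), fed to the linear device
E2_S♭-lin `strainThresholdAlmostLinear_holds` on every `[t₀,t₂]`, `t₂ < T`: growth at the charged points from
E1_S♭ + F_S + AT-MOST-PARITY is `∂ₜq ≤ η(ε)q`; hence `Λ ≤ M'` on `[t₀,T)` and door Λ `subcriticalStrainDoor_holds`
extends. [folklore] -/
theorem parityRatioDoor_holds : ParityRatioDoor := by
  intro ν T t₀ l₀ δ hν ht₀ ht₀T hl₀ hδ hδ1 u p hsol hreg hhyp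
  have hT : 0 < T := lt_of_le_of_lt ht₀ ht₀T
  -- slab sup of `|u|`
  have hK : ∀ t₂ : ℝ, 0 < t₂ → t₂ < T →
      ∃ K₀ : ℝ, 0 ≤ K₀ ∧ ∀ t ∈ Icc 0 t₂, ∀ x : EuclideanSpace ℝ (Fin 3), ‖u t x‖ ≤ K₀ := by
    intro t₂ ht₂0 ht₂T
    have hS : IsClassicalNSSolutionOn (Icc 0 t₂) ν 0 u p :=
      hsol.mono (Icc_subset_Ico_right ht₂T) (uniqueDiffOn_Icc ht₂0)
    exact exists_forall_norm_le_of_hasBoundedSobolevNormsOn hS (hreg t₂ ht₂T)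
  -- ### Step 1: the strain form at `t₀` is bounded
  obtain ⟨M, hM0, hM⟩ : ∃ M : ℝ, 0 ≤ M ∧
      ∀ (x e : EuclideanSpace ℝ (Fin 3)), ‖e‖ = 1 → strainQuad u t₀ x e ≤ M := by
    set T'' : ℝ := (t₀ + T) / 2 with hT''
    have hT''T : T'' < T := by rw [hT'']; linarith
    have ht₀T'' : t₀ ≤ T'' := by rw [hT'']; linarith
    have hsm : ∀ r ∈ Icc 0 T'', ContDiff ℝ ∞ (u r) := fun r hr =>
      hsol.contDiff_velocity ⟨hr.1, lt_of_le_of_lt hr.2 hT''T⟩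
    obtain ⟨C1, hC1⟩ :=
      exists_forall_norm_iteratedFDeriv_le_of_hasBoundedSobolevNormsOn hsm (hreg T'' hT''T) 1
    refine ⟨max C1 0, le_max_right _ _, fun x e he => ?_⟩
    have h := hC1 t₀ ⟨ht₀, ht₀T''⟩ x
    rw [norm_iteratedFDeriv_one] at h
    exact ((strainQuad_le_opNorm u t₀ x he).trans h).trans (le_max_left _ _)
  set M' : ℝ := max M l₀ + 1 with hM'
  have hM'M : M < M' := by rw [hM']; linarith [le_max_left M l₀]
  have hM'l : l₀ < M' := by rw [hM']; linarith [le_max_right M l₀]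
  have hM'pos : 0 < M' := lt_of_le_of_lt hl₀ hM'l
  -- ### Step 2: `⟪∇u e,e⟫ ≤ M'` on `[t₀,T)` (constant barrier, `φ ≡ 0`, through the linear device)
  have hbound : ∀ t ∈ Ico t₀ T, ∀ (x e : EuclideanSpace ℝ (Fin 3)), ‖e‖ = 1 →
      strainQuad u t x e ≤ M' := by
    intro t ht x e he
    set t₂ : ℝ := (t + T) / 2 with ht₂
    have ht₀t₂ : t₀ < t₂ := by rw [ht₂]; linarith [ht.1, ht.2]
    have ht₂T : t₂ < T := by rw [ht₂]; linarith [ht.2]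
    have htt₂ : t ≤ t₂ := by rw [ht₂]; linarith [ht.2]
    obtain ⟨K₀, -, hK₀⟩ := hK t₂ (lt_of_le_of_lt ht₀ ht₀t₂) ht₂T
    have hrate : ∀ ε : ℝ, 0 < ε → ε ≤ 1 → ∀ s ∈ Ioc t₀ t₂, ∀ (x e : EuclideanSpace ℝ (Fin 3)), ‖e‖ = 1 →
        (∀ (y e' : EuclideanSpace ℝ (Fin 3)), ‖e'‖ = 1 →
          (1 + ε * ‖y‖ ^ 2)⁻¹ * strainQuad u s y e' ≤ (1 + ε * ‖x‖ ^ 2)⁻¹ * strainQuad u s x e) →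
        (∀ (y e' : EuclideanSpace ℝ (Fin 3)), ‖e'‖ = 1 → (1 - δ) * strainQuad u s y e' ≤ strainQuad u s x e) →
        (fun _ : ℝ => M') s < strainQuad u s x e →
        strainRate T u s x e ≤
          ((fun _ : ℝ => (0 : ℝ)) s + (6 * ν * ε + Real.sqrt ε * K₀)) * strainQuad u s x e := by
      intro ε hε _ s hs x e he hpen halm hbig
      have hsI : s ∈ Ico 0 T := ⟨ht₀.trans hs.1.le, lt_of_le_of_lt hs.2 ht₂T⟩
      have hsI' : s ∈ Ico t₀ T := ⟨hs.1.le, hsI.2⟩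
      have hbig' : M' < strainQuad u s x e := hbig
      have hq0 : 0 < strainQuad u s x e := hM'pos.trans hbig'
      have hsm : ContDiff ℝ ∞ (u s) := hsol.smooth_velocity.contDiff_slice hsI
      have heq := strainFrame_holds ν T hν hT u p hsol s hsI x e
      have hE := strainGrowthWeighted ν ε hν.le hε (u s) (p s) hsm x e he (fun y => hpen y e he) hq0.le _ heq
      have hfeed := hhyp s hsI' x e ⟨he, halm⟩ (hM'l.trans hbig')
      have hux : ‖u s x‖ ≤ K₀ := hK₀ s ⟨hsI.1, hs.2⟩ x
      have h1 : strainRate T u s x e ≤ -(strainQuad u s x e) ^ 2 + strainFeed u p s x e +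
          (6 * ν * ε + Real.sqrt ε * ‖u s x‖) * strainQuad u s x e := by
        unfold strainRate strainQuad strainFeed pressureHess
        linarith [hE]
      have hallow : (6 * ν * ε + Real.sqrt ε * ‖u s x‖) * strainQuad u s x e ≤
          (6 * ν * ε + Real.sqrt ε * K₀) * strainQuad u s x e := by
        apply mul_le_mul_of_nonneg_right _ hq0.le
        have := mul_le_mul_of_nonneg_left hux (Real.sqrt_nonneg ε)
        linarith
      show strainRate T u s x e ≤ (0 + (6 * ν * ε + Real.sqrt ε * K₀)) * strainQuad u s x e
      rw [zero_add]
      linarith [h1, hallow, hfeed]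
    exact strainThresholdAlmostLinear_holds ν T t₀ t₂ δ (fun ε => 6 * ν * ε + Real.sqrt ε * K₀) hν ht₀
      ht₀t₂ ht₂T hδ hδ1 (tendsto_allowance ν K₀) u p hsol hreg (fun _ => M') (fun _ => 0)
      (fun _ => 0) continuousOn_const (fun _ _ => hM'pos)
      (fun s _ => hasDerivWithinAt_const s (Icc t₀ t₂) M')
      (fun s _ => by simp only [zero_mul, le_refl]) hrate
      (fun x e he => (hM x e he).trans hM'M.le)
      t ⟨ht.1, htt₂⟩ x e he
  -- ### Step 3: door Λ with `y₀ = 1/2` on `[t₁, T)`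
  set t₁ : ℝ := max t₀ (T - 1 / (2 * M')) with ht₁
  have ht₁0 : 0 ≤ t₁ := ht₀.trans (le_max_left _ _)
  have ht₁T : t₁ < T := by
    rw [ht₁]
    refine max_lt ht₀T ?_
    have := div_pos one_pos (mul_pos two_pos hM'pos)
    linarith
  refine subcriticalStrainDoor_holds ν T t₁ (1 / 2) hν ht₁0 ht₁T (by norm_num) u p hsol hreg ?_
  intro t ht x e he
  have hq := hbound t ⟨(le_max_left _ _).trans ht.1, ht.2⟩ x e he
  have hTt : T - t ≤ 1 / (2 * M') := by
    have := (le_max_right t₀ (T - 1 / (2 * M'))).trans ht.1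
    linarith
  have hTt0 : 0 < T - t := sub_pos.2 ht.2
  calc (T - t) * strainQuad u t x e ≤ (T - t) * M' := mul_le_mul_of_nonneg_left hq hTt0.le
    _ ≤ 1 / (2 * M') * M' := mul_le_mul_of_nonneg_right hTt hM'pos.le
    _ = 1 / 2 := by field_simp


end Summit.NavierStokesRegularity.NavierStokesRegularity.Theorems.StrainDoors

end
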